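import Summits.QuantumFields.YangMills.Theorems.BalabanUVNodesN15SiteColouredLayer
import Summits.QuantumFields.YangMills.Theorems.BalabanUVNodesN15FullPropagatorV1XAllLayersN15At
import Summits.QuantumFields.YangMills.Theorems.BalabanUVNodesN15ExpLetters
import HarnessLib

/-!
# Route «BalabanUVNodes», cluster K4 «SpineRates» — node N15 = NE2: THE SITE LAYER WITH THE BACKGROUND LIVE IN THE TwoGrid ENTRY CURRENCY, XXIV — THE NON-ABELIAN SITE LAYER:
# FILE 40's sized gauge-dressed family with the COLOURED massless site propagator `G′ ⊗ 1_𝔤` dressed by the `ad A′`-SPECIES `Σ_μ ad(A′_μ(x,μ))·N∇_μ` (colours MIXED — no abelian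
# component), every colour entry of the dressed coloured site kernel; OPERATOR = FILE 40 (`ad`-species, vector piece ⊗ 1_𝔤), UNIT = part XV: `PairedFamilyGuard.Live ∧ N15At`

Cell `pub-ymgap`, WIDTH SEAT `pub-ymgap-dag-n15-w1` (generation 3; director-ym №197 ∕ HUMAN RULING D-0149; chair R455 (A) ∕ R461; plan g83 `W-SEAT-START-LIST.md` v11 §n15; (α) step 4 of 4 —
g2's located leftover «the non-abelian upgrade», INBOX l.30136).  `bears_on: R4∕N15 · K3⁷ SpineGivenEndpointR13SepCoPH (stmt-QuantumFields-20544)`.  Filed `--supports stmt-QuantumFields-20544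
--as helper` — COUNT-NEUTRAL.  Five plumbing `def`s (the `ad`-species coarse∕fine, the two coloured perturbation matrices, the `NE2Objects₁₁` literal), the rest theorems; 0 `sorry`.  Imports
BY NAME this seat's part XXIII `…N15SiteColouredLayer` (through it parts XXI∕XXII), part XV `…N15FullPropagatorV1XAllLayersN15At` (`v1CovBgEx`, `ne2PlusUnit_v1CovBgEx`,
`reg335_fgInstanceV1GS_explicit`; through it part XII `V1IndexSM`, `live_v1XAS_site`, FILE 40 `fgInstanceV1GS`∕`fgFamilyV1XAS`, S-E `n15At_v1XAS`, n15-b `unstackM`∕`hasMaj_unstackM`∕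
`hasMaj_idef_unstackM`, 13c `fit_blockAvgV`∕`norm_blockAvgV_le`, (V4) `fibre_conn_kingPrV`, 16 `coordMat`∕`basisConst`∕`rowBound_of_opNormBound`∕`rowFit_of_opNormFit`) and dag-n15-c
13a `…N15ExpLetters` (`norm_adCLM_le_of_le`, `norm_adCLM_sub_le`); nothing in the tree is modified.

WHY.  Parts XII∕XV∕XIX dress THE massless scalar site propagator by a species reading an ABELIAN component `φ ∘ A′` of the gauge field («no colour on the scalar site propagator; the
coloured `G′ ⊗ 1_𝔤` site layer is the honest upgrade, not typed» — part XII).  FILE 40's OPERATOR layer already is the non-abelian model: the vector piece `⊗ 1_𝔤` dressed by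
`V′₁(A′)` with `ad A′` in coordinates `e : 𝔄 ≃ ℝ^ι`.  THIS FILE brings the SITE layer to the same level: the `U ≡ 1` site propagator is `G′ ⊗ 1_ι` (part XXIII), the first-order species is
[Balaban1985BackgroundPropagators] (3.52)'s `Σ_μ R′(A′_μ(x,μ))·N∇_μ` with `R′ = ad` in coordinates — n15-b's `unstackM 0 (fun μ x => coordMat e (ad (A′_μ(x,μ))))`, colours MIXED — its three
sized letters are theorems of FILE 40's `Reg335` (row sums `≤ κ_e·2·c₃₅Mα₀` by `rowBound_of_opNormBound` + `‖ad Z‖ ≤ 2‖Z‖`; King-fibre fit by `rowFit_of_opNormFit` + `‖ad Z₁ − ad Z₂‖ ≤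
2‖Z₁ − Z₂‖` + (V4) `fibre_conn_kingPrV`), and part XXIII §3 gives `NE2PlusSite` for EVERY colour entry of the dressed coloured site kernel; with FILE 40's operator layer and part XV's
unit layer this is `Live ∧ N15At` for a family whose site layer carries NO abelianisation.

CONTENTS.  §1 defs `adSiteSpeciesF∕C`, `adSitePertF∕C`; §2 ★ `adSiteSpecies_letters` (three sized letters with `K_ad = 4(d+1)(d+2)κ_e c₃₅`); §3 ★★ `ne2PlusSite_v1XAS_colSite` (every colour
selector pair `(c, c′)`); §4 ★★★ `n15At_v1XCol`, ★★★ `live_and_n15At_v1XCol`; §5 def `v1XColObjects` + `live_and_n15At_v1XColObjects` (`_family`), `populated_…`,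
`s_N15_of_admits_v1XCol_family`; §6 POSITIVE CONTROL — `eq_zero_of_coordMat_eq_zero`, `exists_coordMat_ne_zero`, ★ `adSiteSpeciesF_const_ne_zero` (at a constant NON-CENTRAL gauge
field the `ad`-species is a non-zero operator: the layer's background dependence is genuine exactly where `𝔄` is non-abelian).

HONEST FRAMING.  Count-neutral KNIT; no new estimate.  MODEL-LEVEL as FILE 40 is (first-order `ad`-species at `U ≡ 1` background geometry, plain block means, King's pairing, the
window transport `Ā′ = gavgM A′`); the averaging perturbation `F₂` is NOT carried on this road (parts XVII–XIX carry it on the abelian road); the unit layer stays part XV's abelianised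
pair `(0, φ∘A′)`; what each site kernel reads is ONE colour entry `(c, c′)` of the dressed coloured inverse — every entry, uniform constants.  NOT Bałaban's `G(U)` at a general
(3.35)-regular `U` with parallel transports ([B9] Thms 3.1∕3.2∕3.15 NOT PRINTED as η-rates); Node 00's [B9] layers of record are residual — **N15 is NOT discharged** (typed 28∕28 ·
discharged 5∕27 of record unchanged); K3⁷ OPEN and not claimed (its v5 pins N15 to `fullGSizedObjects`; this literal is a re-pin CANDIDATE only); one finite four-torus programme at
fixed `ε` — NOT ℝ⁴, NOT infinite volume, NOT OS, NOT a mass gap, NOT Clay; R4 closes the conditional finite-𝕋⁴ rung `BalabanLadder.UV` only.  Restate-immune (no Theses import).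
-/

set_option autoImplicit false

noncomputable section

open scoped BigOperators Matrix
open Finset

namespace Summit.QuantumFields.YangMills.BalabanUVNodes.N15.SiteLayerBg

open Literature.MathematicalPhysics.QuantumFieldTheory.Balaban1983to89
open Literature.MathematicalPhysics.QuantumFieldTheory.Balaban1983to89.T4Continuum (T4Family ULoop)
open Literature.MathematicalPhysics.QuantumFieldTheory.Balaban1983to89.B11SectG (BlockNorm HasMaj)
open Literature.MathematicalPhysics.QuantumFieldTheory.Balaban1983to89.T4EtaRate (PairedInstance EtaPairing NE2PlusOperator NE2PlusSite NE2PlusUnit)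
open Literature.MathematicalPhysics.QuantumFieldTheory.Balaban1983to89.T4EtaRateDefect (idef)
open Literature.MathematicalPhysics.QuantumFieldTheory.Balaban1983to89.T4EtaRateCoeffDefect (pull diagK diagK_mono)
open Literature.MathematicalPhysics.QuantumFieldTheory.Balaban1983to89.B5Prop11Plancherel (Tor fine)
open Literature.MathematicalPhysics.QuantumFieldTheory.Balaban1983to89.B5QGGQ145Bounds (Idx)
open Literature.MathematicalPhysics.QuantumFieldTheory.Balaban1983to89.NE2NodeTorus (ne2PlusOperator_reindex)
open Literature.MathematicalPhysics.QuantumFieldTheory.Balaban1983to89.Beta.AveragingCorrectionJets (adCLM)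
open Literature.MathematicalPhysics.QuantumFieldTheory.King1986.Torus (blockOf)
open Summit.QuantumFields.BalabanUV.T4Continuum.HistoryFlow (two_le_L)
open Summit.QuantumFields.YangMills.BalabanUVNodes.N15.TwoGrid (TGIndex)
open Summit.QuantumFields.YangMills.BalabanUVNodes.N15.VectorPiece (unitTorusGeoS kingPrV bshiftEquiv blkFine fibre_conn_kingPrV tensorId)
open Summit.QuantumFields.YangMills.BalabanUVNodes.N15.MatrixSpecies (liftMap liftBlk coordMat basisConst basisConst_nonneg rowBound_of_opNormBound rowFit_of_opNormFit
  norm_adCLM_le_of_le norm_adCLM_sub_le blockAvgV fit_blockAvgV norm_blockAvgV_le)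
open Summit.QuantumFields.YangMills.BalabanUVNodes.N15.BackgroundLayer (blkPair liftPair unstackM unstackM_apply hasMaj_unstackM hasMaj_idef_unstackM inv_pow_le_rate gavgM fgInstanceV1GS fgFamilyV1XAS)
open Summit.QuantumFields.YangMills.BalabanUVNodes.N15.SiteLayer (dressedOp)
open Summit.QuantumFields.YangMills.BalabanUVNodes.N15.GenuineRecord (TGIndexS n15At_v1XAS)
open Summit.QuantumFields.YangMills.BalabanUVNodes.N15.PairedFamilyGuard (Live)
open Summit.QuantumFields.YangMills.BalabanUVNodes.N15.AtKeyedHome (s_N15_of_admits neZero_blockFactor)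
open Summit.QuantumFields.YangMills.BalabanUVNodes.N15KingModelRung.Curved (kingGOp kingDOp underPtN)
open YMDAG.UVSplit (Datum RateCarriers RateRecordPred N15At S_N15 ne2OfRecord₁₁)

variable {d : ℕ} {L : ℕ} [NeZero L]
variable (d) (𝔄 : Type) [NormedRing 𝔄] [NormedAlgebra ℝ 𝔄] [CompleteSpace 𝔄] (ι : Type) [Fintype ι] [DecidableEq ι] [Nonempty ι] (e : 𝔄 ≃L[ℝ] (ι → ℝ)) (φ : 𝔄 →L[ℝ] ℝ)

/-! ## §1 The `ad A′`-species of the coloured site layer and the coloured (3.65) perturbation matrices -/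

section Species

/-- THE `ad A′`-SPECIES OF THE FINE RUN at index `(j, ν)`: `V̂(A′)λ̂(x, i) = Σ_μ Σ_j [ad(A′_μ(x,μ))]_{ij}·λ̂((x, j), some μ)` in coordinates `e` — (3.52)'s first-order shape `Σ_μ R′(A′_μ)·N∇_μ`
with `R′ = ad`, colours MIXED; n15-b's `unstackM` with the site coefficient `0`. [cite: Balaban1985BackgroundPropagators, (3.52) p.400 (first-order perturbation: shape); (3.1)–(3.5) p.390 (the representation `R(U)`)] -/
def adSiteSpeciesF (hL : Odd L ∧ 1 < L) (j : TGIndexS × Fin (d + 1)) (A : (fgInstanceV1GS d 𝔄 ι hL j).Bf.Cfg) :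
    ((Tor (fine (L ^ j.1.m * L ^ j.1.k) (TGIndex.Mn d hL j.1.toTGIndex)) × ι) × Option (Fin (d + 1)) → ℝ) →ₗ[ℝ]
      (Tor (fine (L ^ j.1.m * L ^ j.1.k) (TGIndex.Mn d hL j.1.toTGIndex)) × ι → ℝ) :=
  unstackM (fun _ => 0) (fun μ x => coordMat e (adCLM ℝ (A μ (x, μ))))

/-- THE `ad`-SPECIES OF THE COARSE RUN at `(j, ν)` (same reading of a coarse gauge field). [cite: Balaban1985BackgroundPropagators, (3.52) p.400 (shape)] -/
def adSiteSpeciesC (hL : Odd L ∧ 1 < L) (j : TGIndexS × Fin (d + 1)) (B : (fgInstanceV1GS d 𝔄 ι hL j).Bc.Cfg) :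
    ((Tor (fine (L ^ j.1.k) (TGIndex.Mn d hL j.1.toTGIndex)) × ι) × Option (Fin (d + 1)) → ℝ) →ₗ[ℝ] (Tor (fine (L ^ j.1.k) (TGIndex.Mn d hL j.1.toTGIndex)) × ι → ℝ) :=
  unstackM (fun _ => 0) (fun μ x => coordMat e (adCLM ℝ (B μ (x, μ))))

/-- THE FINE RUN's COLOURED (3.65) SITE PERTURBATION MATRIX on `Idx M × ι`: part XXII's `siteEntriesC (sitePertC (blockOf ∘ pr lifted) (G′ ⊗ 1) (dressedOp (G′ ⊗ 1) (D ⊗ 1) V̂(A′)))`,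
`G′` THE massless scalar site propagator of the fine run. [cite: Balaban1985BackgroundPropagators, (3.65) p.403 (shape)] -/
def adSitePertF (hL : Odd L ∧ 1 < L) (aS : ℝ) (j : TGIndexS × Fin (d + 1)) (A : (fgInstanceV1GS d 𝔄 ι hL j).Bf.Cfg) :
    Matrix (Idx (TGIndex.Mn d hL j.1.toTGIndex) × ι) (Idx (TGIndex.Mn d hL j.1.toTGIndex) × ι) ℝ :=
  siteEntriesC (TGIndex.Mn d hL j.1.toTGIndex) ι (sitePertC (TGIndex.Mn d hL j.1.toTGIndex) ι
    (liftMap (blockOf (L ^ j.1.k) (TGIndex.Mn d hL j.1.toTGIndex) ∘ underPtN L j.1.k j.1.m (TGIndex.Mn d hL j.1.toTGIndex)) ι)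
    (tensorId ι (kingGOp L aS 0 (j.1.k + j.1.m) (L ^ j.1.m * L ^ j.1.k) (TGIndex.Mn d hL j.1.toTGIndex)))
    (dressedOp (tensorId ι (kingGOp L aS 0 (j.1.k + j.1.m) (L ^ j.1.m * L ^ j.1.k) (TGIndex.Mn d hL j.1.toTGIndex)))
      (fun μ => tensorId ι (kingDOp L aS 0 (j.1.k + j.1.m) (L ^ j.1.m * L ^ j.1.k) (TGIndex.Mn d hL j.1.toTGIndex) μ)) (adSiteSpeciesF d 𝔄 ι e hL j A)))

/-- THE COARSE RUN's COLOURED (3.65) SITE PERTURBATION MATRIX (`G′ = kingGOp L a_S 0 k (L^k) M`). [cite: Balaban1985BackgroundPropagators, (3.65) p.403 (shape)] -/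
def adSitePertC (hL : Odd L ∧ 1 < L) (aS : ℝ) (j : TGIndexS × Fin (d + 1)) (B : (fgInstanceV1GS d 𝔄 ι hL j).Bc.Cfg) :
    Matrix (Idx (TGIndex.Mn d hL j.1.toTGIndex) × ι) (Idx (TGIndex.Mn d hL j.1.toTGIndex) × ι) ℝ :=
  siteEntriesC (TGIndex.Mn d hL j.1.toTGIndex) ι (sitePertC (TGIndex.Mn d hL j.1.toTGIndex) ι (liftMap (blockOf (L ^ j.1.k) (TGIndex.Mn d hL j.1.toTGIndex)) ι)
    (tensorId ι (kingGOp L aS 0 j.1.k (L ^ j.1.k) (TGIndex.Mn d hL j.1.toTGIndex)))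
    (dressedOp (tensorId ι (kingGOp L aS 0 j.1.k (L ^ j.1.k) (TGIndex.Mn d hL j.1.toTGIndex))) (fun μ => tensorId ι (kingDOp L aS 0 j.1.k (L ^ j.1.k) (TGIndex.Mn d hL j.1.toTGIndex) μ))
      (adSiteSpeciesC d 𝔄 ι e hL j B)))

end Species

/-! ## §2 ★ The `ad`-species' three diagonal letters AT SIZE from FILE 40's `Reg335` -/

section Letters

omit [CompleteSpace 𝔄] [Nonempty ι] in
/-- ★ **THE THREE DIAGONAL LETTERS OF THE `ad`-SPECIES AT SIZE.**  For `c₃₅ ≥ 0`, `γ ≤ 2`, an index `(j, ν)`, `α₀ > 0` and a fine gauge field `A′` in FILE 40's (3.35) window at `(c₃₅, α₀)`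
(`‖A′‖ ≤ c₃₅M_jα₀`, one-step differences `≤ c₃₅M_jα₀·η′`): with `K_ad = 4(d+1)(d+2)κ_e c₃₅` (`κ_e = basisConst e`) the species satisfy `V̂_c(Ā′) ≤ diagK (K_ad (M_jα₀))` on `blkPair (liftBlk blockOf ι)`
(row sums `≤ 2κ_e c₃₅M_jα₀` per derived component: `‖ad Z‖ ≤ 2‖Z‖`, `rowBound_of_opNormBound`, `norm_blockAvgV_le`; n15-b `hasMaj_unstackM`), `V̂_f(A′) ≤ diagK (K_ad (M_jα₀))` on
`blkPair (liftBlk (blockOf ∘ pr) ι)`, and the fit `𝔇(V̂_f(A′), V̂_c(Ā′)) ≤ diagK (K_ad (M_jα₀)(L^k)^{−γ∕2})` through `(pull (liftPair (liftMap pr ι)), pull (liftMap pr ι))` (`‖ad Z₁ − ad Z₂‖ ≤ 2‖Z₁ − Z₂‖`,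
`rowFit_of_opNormFit`, King-fibre oscillation `fibre_conn_kingPrV` + `fit_blockAvgV` `≤ 2(d+1)c₃₅M_jα₀L^{−k}`; `hasMaj_idef_unstackM`). [cite: Balaban1985BackgroundPropagators, (3.35) p.396 (letters at size, shape), (3.52) p.400 (shape); King1986, p.664 (pairing)] -/
theorem adSiteSpecies_letters (hL : Odd L ∧ 1 < L) {c35 : ℝ} (hc35 : 0 ≤ c35) {γ : ℝ} (hγ2 : γ ≤ 2) (j : TGIndexS × Fin (d + 1)) {α₀ : ℝ} (hα₀ : 0 < α₀)
    (A : (fgInstanceV1GS d 𝔄 ι hL j).Bf.Cfg) (hA : (fgInstanceV1GS d 𝔄 ι hL j).Bf.Reg335 c35 α₀ A) :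
    HasMaj (BlockNorm.ofBlocks (unitTorusGeoS L j.1.k (TGIndex.Mn d hL j.1.toTGIndex) j.1.Msz) (blkPair (liftBlk (blockOf (L ^ j.1.k) (TGIndex.Mn d hL j.1.toTGIndex)) ι)))
        (BlockNorm.ofBlocks (unitTorusGeoS L j.1.k (TGIndex.Mn d hL j.1.toTGIndex) j.1.Msz) (liftBlk (blockOf (L ^ j.1.k) (TGIndex.Mn d hL j.1.toTGIndex)) ι))
        (adSiteSpeciesC d 𝔄 ι e hL j ((fgInstanceV1GS d 𝔄 ι hL j).pair.avg A)) (diagK fun _ => 4 * ((d : ℝ) + 1) * ((d : ℝ) + 2) * basisConst e * c35 * (j.1.Msz * α₀)) ∧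
      HasMaj (BlockNorm.ofBlocks (unitTorusGeoS L j.1.k (TGIndex.Mn d hL j.1.toTGIndex) j.1.Msz)
          (blkPair (liftBlk (blockOf (L ^ j.1.k) (TGIndex.Mn d hL j.1.toTGIndex) ∘ underPtN L j.1.k j.1.m (TGIndex.Mn d hL j.1.toTGIndex)) ι)))
        (BlockNorm.ofBlocks (unitTorusGeoS L j.1.k (TGIndex.Mn d hL j.1.toTGIndex) j.1.Msz)
          (liftBlk (blockOf (L ^ j.1.k) (TGIndex.Mn d hL j.1.toTGIndex) ∘ underPtN L j.1.k j.1.m (TGIndex.Mn d hL j.1.toTGIndex)) ι))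
        (adSiteSpeciesF d 𝔄 ι e hL j A) (diagK fun _ => 4 * ((d : ℝ) + 1) * ((d : ℝ) + 2) * basisConst e * c35 * (j.1.Msz * α₀)) ∧
      HasMaj (BlockNorm.ofBlocks (unitTorusGeoS L j.1.k (TGIndex.Mn d hL j.1.toTGIndex) j.1.Msz) (blkPair (liftBlk (blockOf (L ^ j.1.k) (TGIndex.Mn d hL j.1.toTGIndex)) ι)))
        (BlockNorm.ofBlocks (unitTorusGeoS L j.1.k (TGIndex.Mn d hL j.1.toTGIndex) j.1.Msz)
          (liftBlk (blockOf (L ^ j.1.k) (TGIndex.Mn d hL j.1.toTGIndex) ∘ underPtN L j.1.k j.1.m (TGIndex.Mn d hL j.1.toTGIndex)) ι))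
        (idef (pull (liftPair (liftMap (underPtN L j.1.k j.1.m (TGIndex.Mn d hL j.1.toTGIndex)) ι))) (pull (liftMap (underPtN L j.1.k j.1.m (TGIndex.Mn d hL j.1.toTGIndex)) ι))
          (adSiteSpeciesF d 𝔄 ι e hL j A) (adSiteSpeciesC d 𝔄 ι e hL j ((fgInstanceV1GS d 𝔄 ι hL j).pair.avg A)))
        (diagK fun _ => 4 * ((d : ℝ) + 1) * ((d : ℝ) + 2) * basisConst e * c35 * (j.1.Msz * α₀) * ((L : ℝ) ^ j.1.k) ^ (-(γ / 2))) := by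
  obtain ⟨hA1, hA2, -⟩ := reg335_fgInstanceV1GS_explicit d 𝔄 ι hL j c35 α₀ A hA
  set M := TGIndex.Mn d hL j.1.toTGIndex with hMdef
  set k := j.1.k with hkdef
  set m := j.1.m with hmdef
  have hL0 : 0 < L := Nat.pos_of_ne_zero (NeZero.ne L)
  have hL1 : (1 : ℝ) ≤ (L : ℝ) := by exact_mod_cast hL0
  have hMsz : 0 ≤ j.1.Msz := le_trans zero_le_one j.1.one_le_Msz
  have hκ : 0 ≤ basisConst e := basisConst_nonneg e
  have hd0 : (0 : ℝ) ≤ d := Nat.cast_nonneg d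
  have hcard : (Fintype.card (Fin (d + 1)) : ℝ) = (d : ℝ) + 1 := by rw [Fintype.card_fin]; push_cast; ring
  have hθ : 0 ≤ ((L : ℝ) ^ k) ^ (-(γ / 2)) := Real.rpow_nonneg (pow_nonneg (Nat.cast_nonneg _) _) _
  set s : ℝ := j.1.Msz * α₀ with hsdef
  have hs : 0 ≤ s := mul_nonneg hMsz hα₀.le
  have hAn : ∀ μ b, ‖A μ b‖ ≤ c35 * s := fun μ b => (hA1 μ b).trans_eq (by rw [hsdef]; ring)
  have havg : (fgInstanceV1GS d 𝔄 ι hL j).pair.avg A = gavgM 𝔄 (Fin (d + 1)) (kingPrV L k m M) A := rfl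
  rw [havg]
  have hAbar : ∀ μ b, ‖gavgM 𝔄 (Fin (d + 1)) (kingPrV L k m M) A μ b‖ ≤ c35 * s := fun μ b => norm_blockAvgV_le _ (mul_nonneg hc35 hs) (hAn μ) _
  -- row sums of the `ad` coefficient matrices: `≤ κ_e · 2c₃₅s`
  set r : ℝ := basisConst e * (2 * (c35 * s)) with hrdef
  have hr : 0 ≤ r := by positivity
  have hrowF : ∀ μ (x : Tor (fine (L ^ m * L ^ k) M)) i, ∑ j', |coordMat e (adCLM ℝ (A μ (x, μ))) i j'| ≤ r :=
    fun μ x i => rowBound_of_opNormBound e (C := fun x : Tor (fine (L ^ m * L ^ k) M) => adCLM ℝ (A μ (x, μ))) (fun x => norm_adCLM_le_of_le (hAn μ (x, μ))) x i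
  have hrowC : ∀ μ (x : Tor (fine (L ^ k) M)) i, ∑ j', |coordMat e (adCLM ℝ (gavgM 𝔄 (Fin (d + 1)) (kingPrV L k m M) A μ (x, μ))) i j'| ≤ r :=
    fun μ x i => rowBound_of_opNormBound e (C := fun x : Tor (fine (L ^ k) M) => adCLM ℝ (gavgM 𝔄 (Fin (d + 1)) (kingPrV L k m M) A μ (x, μ)))
      (fun x => norm_adCLM_le_of_le (hAbar μ (x, μ))) x i
  have hrow0 : ∀ {Y : Type} (x : Y) (i : ι), ∑ j', |(fun _ : Y => (0 : Matrix ι ι ℝ)) x i j'| ≤ r := fun x i => by simp [hr]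
  -- the size constant `r(1 + (d+1)) ≤ K_ad s`
  have hsize : r * (1 + (Fintype.card (Fin (d + 1)) : ℝ)) ≤ 4 * ((d : ℝ) + 1) * ((d : ℝ) + 2) * basisConst e * c35 * s := by
    rw [hcard, hrdef]; nlinarith [mul_nonneg (mul_nonneg hκ (mul_nonneg hc35 hs)) hd0, mul_nonneg hκ (mul_nonneg hc35 hs)]
  refine ⟨?_, ?_, ?_⟩
  · have h := hasMaj_unstackM (g := unitTorusGeoS L k M j.1.Msz) (ι := ι) (J := Fin (d + 1)) (blockOf (L ^ k) M)
      (C := fun _ => (0 : Matrix ι ι ℝ)) (A := fun μ x => coordMat e (adCLM ℝ (gavgM 𝔄 (Fin (d + 1)) (kingPrV L k m M) A μ (x, μ)))) hr (fun x i => hrow0 x i)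
      (fun μ x i => hrowC μ x i)
    exact h.mono fun y y' => diagK_mono (fun _ => hsize) y y'
  · have h := hasMaj_unstackM (g := unitTorusGeoS L k M j.1.Msz) (ι := ι) (J := Fin (d + 1)) (blockOf (L ^ k) M ∘ underPtN L k m M)
      (C := fun _ => (0 : Matrix ι ι ℝ)) (A := fun μ x => coordMat e (adCLM ℝ (A μ (x, μ)))) hr (fun x i => hrow0 x i) (fun μ x i => hrowF μ x i)
    exact h.mono fun y y' => diagK_mono (fun _ => hsize) y y'
  · -- the fit: `‖ad A′(x′) − ad Ā′(pr x′)‖ ≤ 2‖A′(x′) − Ā′(pr x′)‖ ≤ 2·(fibre oscillation)`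
    have hstep : ∀ μ κ b, ‖A μ (bshiftEquiv M (L ^ m * L ^ k) κ b) - A μ b‖ ≤ c35 * s * ((((L : ℝ) ^ k))⁻¹ * (((L : ℝ) ^ m))⁻¹) := fun μ κ b =>
      (hA2 μ κ b).trans_eq (by rw [hsdef]; ring)
    set Ω : ℝ := ((2 * ((d + 1) * (L ^ m - 1)) : ℕ) : ℝ) * (c35 * s * ((((L : ℝ) ^ k))⁻¹ * (((L : ℝ) ^ m))⁻¹)) with hΩdef
    have hΩ0 : 0 ≤ Ω := by positivity
    have hfitA : ∀ μ (b' : Tor (fine (L ^ m * L ^ k) M) × Fin (d + 1)), ‖A μ b' - gavgM 𝔄 (Fin (d + 1)) (kingPrV L k m M) A μ (kingPrV L k m M b')‖ ≤ Ω := fun μ b' =>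
      fit_blockAvgV (kingPrV L k m M) (Ω := fun _ => Ω) (fun x₁' x₂' h => fibre_conn_kingPrV L k m M (A μ) _ (fun κ i => hstep μ κ i) x₁' x₂' h) b'
    have hΩle : Ω ≤ 2 * ((d : ℝ) + 1) * (c35 * s) * (((L ^ k : ℕ) : ℝ))⁻¹ := by
      have hLm : (0 : ℝ) < (L : ℝ) ^ m := by positivity
      have hLk : (0 : ℝ) < (L : ℝ) ^ k := by positivity
      have h1 : ((2 * ((d + 1) * (L ^ m - 1)) : ℕ) : ℝ) ≤ 2 * ((d : ℝ) + 1) * (L : ℝ) ^ m := by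
        have : ((L ^ m - 1 : ℕ) : ℝ) ≤ ((L ^ m : ℕ) : ℝ) := by exact_mod_cast Nat.sub_le _ _
        push_cast [Nat.cast_sub (Nat.one_le_pow _ _ hL0)] at this ⊢
        nlinarith
      calc Ω ≤ 2 * ((d : ℝ) + 1) * (L : ℝ) ^ m * (c35 * s * ((((L : ℝ) ^ k))⁻¹ * (((L : ℝ) ^ m))⁻¹)) := mul_le_mul_of_nonneg_right h1 (by positivity)
        _ = 2 * ((d : ℝ) + 1) * (c35 * s) * (((L ^ k : ℕ) : ℝ))⁻¹ := by push_cast; field_simp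
    have hrate : (((L ^ k : ℕ) : ℝ))⁻¹ ≤ ((L : ℝ) ^ k) ^ (-(γ / 2)) := inv_pow_le_rate (L := L) hL1 (by linarith)
    set o : ℝ := basisConst e * (2 * Ω) with hodef
    have ho : 0 ≤ o := by positivity
    have hfitRow : ∀ μ (x' : Tor (fine (L ^ m * L ^ k) M)) i,
        ∑ j', |coordMat e (adCLM ℝ (A μ (x', μ))) i j' - coordMat e (adCLM ℝ (gavgM 𝔄 (Fin (d + 1)) (kingPrV L k m M) A μ (underPtN L k m M x', μ))) i j'| ≤ o := fun μ x' i => by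
      have h := rowFit_of_opNormFit e (underPtN L k m M) (C' := fun x' : Tor (fine (L ^ m * L ^ k) M) => adCLM ℝ (A μ (x', μ)))
        (C := fun x : Tor (fine (L ^ k) M) => adCLM ℝ (gavgM 𝔄 (Fin (d + 1)) (kingPrV L k m M) A μ (x, μ))) (o := fun _ => 2 * Ω)
        (fun x' => (norm_adCLM_sub_le _ _).trans (mul_le_mul_of_nonneg_left (hfitA μ (x', μ)) zero_le_two)) x' i
      rw [hodef]; exact h
    have hfit0 : ∀ (x' : Tor (fine (L ^ m * L ^ k) M)) (i : ι), ∑ j', |(fun _ : Tor (fine (L ^ m * L ^ k) M) => (0 : Matrix ι ι ℝ)) x' i j'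
        - (fun _ : Tor (fine (L ^ k) M) => (0 : Matrix ι ι ℝ)) (underPtN L k m M x') i j'| ≤ o := fun x' i => by simp [ho]
    have h := hasMaj_idef_unstackM (g := unitTorusGeoS L k M j.1.Msz) (ι := ι) (J := Fin (d + 1)) (blockOf (L ^ k) M) (underPtN L k m M)
      (C := fun _ => (0 : Matrix ι ι ℝ)) (A := fun μ x => coordMat e (adCLM ℝ (gavgM 𝔄 (Fin (d + 1)) (kingPrV L k m M) A μ (x, μ))))
      (C' := fun _ => (0 : Matrix ι ι ℝ)) (A' := fun μ x' => coordMat e (adCLM ℝ (A μ (x', μ)))) ho (fun x' i => hfit0 x' i) (fun μ x' i => hfitRow μ x' i)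
    refine h.mono fun y y' => diagK_mono (fun _ => ?_) y y'
    -- `o(1 + (d+1)) ≤ K_ad s θ`
    rw [hcard, hodef]
    have h2 : Ω ≤ 2 * ((d : ℝ) + 1) * (c35 * s) * ((L : ℝ) ^ k) ^ (-(γ / 2)) := hΩle.trans (mul_le_mul_of_nonneg_left hrate (by positivity))
    nlinarith [mul_le_mul_of_nonneg_left h2 (show 0 ≤ basisConst e * 2 * (1 + ((d : ℝ) + 1)) by positivity),
      mul_nonneg (mul_nonneg (mul_nonneg hκ (mul_nonneg hc35 hs)) hθ) hd0, mul_nonneg (mul_nonneg hκ (mul_nonneg hc35 hs)) hθ]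

end Letters

/-! ## §3 ★★ `NE2PlusSite` for every colour entry on the sized family, `ad`-species live -/

section Site

omit [CompleteSpace 𝔄] [Nonempty ι] in
/-- ★★ **`NE2PlusSite` FOR EVERY COLOUR ENTRY OF THE `ad`-DRESSED COLOURED SITE KERNEL ON FILE 40's SIZED GAUGE-DRESSED FAMILY** (sub-index `m ≥ 1`, colour selectors `(c, c′)`): part XXIII §3 ∘ §2.
`d ≥ 0`, odd `L ≥ 3`, `a_S > 0`, `c₃₅ ≥ 0`. [cite: Balaban1985BackgroundPropagators, Thm 3.2 (3.48) p.398 + Thm 3.14 pp.426–427 (quantifier template), (3.52) p.400, (3.63)–(3.67) pp.402–403 (mechanism); Balaban1984PropagatorsI, (1.45) p.26; King1986, Prop. 3.8 (3.71) p.664] -/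
theorem ne2PlusSite_v1XAS_colSite (hLodd : Odd L) (hL2 : 2 ≤ L) (hL : Odd L ∧ 1 < L) {aS : ℝ} (haS : 0 < aS) {c35 : ℝ} (hc35 : 0 ≤ c35) (p : ℝ) (c c' : V1IndexSM d → ι) :
    NE2PlusSite 4 p c35 (fun j : V1IndexSM d => fgInstanceV1GS d 𝔄 ι hL j.1)
      (cSiteExOn ι (fun j : V1IndexSM d => TGIndex.Mn d hL j.1.1.toTGIndex) (fun j => j.1.1.k) (fun j => j.1.1.m) (fun j => j.1.1.Msz)
        (fun j => (Tor (fine (L ^ j.1.1.k) (TGIndex.Mn d hL j.1.1.toTGIndex)) × Fin (d + 1)) × ι) (fun j => liftBlk (blkFine L j.1.1.k (TGIndex.Mn d hL j.1.1.toTGIndex)) ι)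
        (fun j => (fgInstanceV1GS d 𝔄 ι hL j.1).gf) (fun j => (fgInstanceV1GS d 𝔄 ι hL j.1).Bc) (fun j => (fgInstanceV1GS d 𝔄 ι hL j.1).Bf) aS
        (fun j => (fgInstanceV1GS d 𝔄 ι hL j.1).pair) (fun j A => adSitePertF d 𝔄 ι e hL aS j.1 A) (fun j B => adSitePertC d 𝔄 ι e hL aS j.1 B) c c') :=
  ne2PlusSite_cSiteExOn_of_sizedSpeciesLettersM (L := L) ι (fun j : V1IndexSM d => TGIndex.Mn d hL j.1.1.toTGIndex) (fun j => j.1.1.k) (fun j => j.1.1.m) (fun j => j.1.1.Msz)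
    (fun j => (Tor (fine (L ^ j.1.1.k) (TGIndex.Mn d hL j.1.1.toTGIndex)) × Fin (d + 1)) × ι) (fun j => liftBlk (blkFine L j.1.1.k (TGIndex.Mn d hL j.1.1.toTGIndex)) ι)
    (fun j => (fgInstanceV1GS d 𝔄 ι hL j.1).gf) (fun j => (fgInstanceV1GS d 𝔄 ι hL j.1).Bc) (fun j => (fgInstanceV1GS d 𝔄 ι hL j.1).Bf)
    (fun j => adSiteSpeciesC d 𝔄 ι e hL j.1) (fun j => adSiteSpeciesF d 𝔄 ι e hL j.1) hLodd hL2 haS c35 4 p one_half_pos (by norm_num) (mT := fun j => j.1.1.mT)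
    (fun _ _ => rfl) (fun j => j.1.1.one_le) (fun j => j.2) (fun j => j.1.1.one_le_Msz) (fun j => (fgInstanceV1GS d 𝔄 ι hL j.1).pair)
    ⟨4 * ((d : ℝ) + 1) * ((d : ℝ) + 2) * basisConst e * c35, 1, by have := basisConst_nonneg e; positivity, one_pos,
      fun j α₀ hα₀ _ A hA => adSiteSpecies_letters d 𝔄 ι e hL hc35 (by norm_num) j.1 hα₀ A hA⟩ c c'

end Site

/-! ## §4 ★★★ `Live ∧ N15At` with the non-abelian site layer -/

section Knit

/-- ★★★ **`N15At` FOR THE SIZED GAUGE-DRESSED FAMILY WITH THE NON-ABELIAN (`ad`-DRESSED, COLOURED) SITE LAYER** (sub-index `m ≥ 1`, colour entry `(c, c′)`): OPERATOR = FILE 40 `fgFamilyV1XAS`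
(S-E `n15At_v1XAS`'s first conjunct, reindexed), SITE = §3, UNIT = part XV `ne2PlusUnit_v1CovBgEx`.  `d ≥ 1`, odd `L ≥ 3`, `b, a_S, c₃₅ > 0`, `|φ| ≤ ‖·‖`. [bookkeeping] -/
theorem n15At_v1XCol (hd : 1 ≤ d) (hLodd : Odd L) (hL2 : 2 ≤ L) (hL : Odd L ∧ 1 < L) {b aS c35 : ℝ} (hb : 0 < b) (haS : 0 < aS) (hc35 : 0 < c35)
    (hφ : ∀ a : 𝔄, |φ a| ≤ ‖a‖) (α β : Fin (d + 1)) (p : ℝ) (c c' : V1IndexSM d → ι) :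
    N15At { I := V1IndexSM d, c35 := c35, p := p, pi := fun j => fgInstanceV1GS d 𝔄 ι hL j.1, Kop := fun j => fgFamilyV1XAS d 𝔄 ι e hL b j.1,
            Ksite := cSiteExOn ι (fun j : V1IndexSM d => TGIndex.Mn d hL j.1.1.toTGIndex) (fun j => j.1.1.k) (fun j => j.1.1.m) (fun j => j.1.1.Msz)
              (fun j => (Tor (fine (L ^ j.1.1.k) (TGIndex.Mn d hL j.1.1.toTGIndex)) × Fin (d + 1)) × ι) (fun j => liftBlk (blkFine L j.1.1.k (TGIndex.Mn d hL j.1.1.toTGIndex)) ι)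
              (fun j => (fgInstanceV1GS d 𝔄 ι hL j.1).gf) (fun j => (fgInstanceV1GS d 𝔄 ι hL j.1).Bc) (fun j => (fgInstanceV1GS d 𝔄 ι hL j.1).Bf) aS
              (fun j => (fgInstanceV1GS d 𝔄 ι hL j.1).pair) (fun j A => adSitePertF d 𝔄 ι e hL aS j.1 A) (fun j B => adSitePertC d 𝔄 ι e hL aS j.1 B) c c',
            Kunit := fun j => v1CovBgEx d 𝔄 ι φ hL b α β j.1, inΛ := fun _ _ => True, unitDist := fun j => (fgInstanceV1GS d 𝔄 ι hL j.1).gc.dist } := by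
  have h := n15At_v1XAS 𝔄 ι e hd hLodd hL2 hL hb haS hc35 α β p
  exact ⟨ne2PlusOperator_reindex (fun j : V1IndexSM d => j.1) h.1, ne2PlusSite_v1XAS_colSite d 𝔄 ι e hLodd hL2 hL haS hc35.le p c c',
    ne2PlusUnit_v1CovBgEx d 𝔄 ι φ hd hLodd hL2 hL hb hc35 hφ α β⟩

/-- ★★★ **GUARD ∧ `N15At` — THE `Live` SIZE-LIVE FAMILY WITH THE NON-ABELIAN SITE LAYER** (operator: FILE 40's `ad`-species; site: §3's `ad`-dressed coloured massless site propagator, colour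
entry `(c, c′)`; unit: part XV's exactly dressed (2.156) kernel): `d ≥ 1`, odd `L ≥ 3`, `b, a_S, c₃₅ > 0`, `|φ| ≤ ‖·‖`. [bookkeeping] -/
theorem live_and_n15At_v1XCol (hd : 1 ≤ d) (hLodd : Odd L) (hL2 : 2 ≤ L) (hL : Odd L ∧ 1 < L) {b aS c35 : ℝ} (hb : 0 < b) (haS : 0 < aS) (hc35 : 0 < c35)
    (hφ : ∀ a : 𝔄, |φ a| ≤ ‖a‖) (α β : Fin (d + 1)) (p : ℝ) (c c' : V1IndexSM d → ι) :
    Live ⟨V1IndexSM d, c35, p, fun j => fgInstanceV1GS d 𝔄 ι hL j.1, fun j => fgFamilyV1XAS d 𝔄 ι e hL b j.1,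
        cSiteExOn ι (fun j : V1IndexSM d => TGIndex.Mn d hL j.1.1.toTGIndex) (fun j => j.1.1.k) (fun j => j.1.1.m) (fun j => j.1.1.Msz)
          (fun j => (Tor (fine (L ^ j.1.1.k) (TGIndex.Mn d hL j.1.1.toTGIndex)) × Fin (d + 1)) × ι) (fun j => liftBlk (blkFine L j.1.1.k (TGIndex.Mn d hL j.1.1.toTGIndex)) ι)
          (fun j => (fgInstanceV1GS d 𝔄 ι hL j.1).gf) (fun j => (fgInstanceV1GS d 𝔄 ι hL j.1).Bc) (fun j => (fgInstanceV1GS d 𝔄 ι hL j.1).Bf) aS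
          (fun j => (fgInstanceV1GS d 𝔄 ι hL j.1).pair) (fun j A => adSitePertF d 𝔄 ι e hL aS j.1 A) (fun j B => adSitePertC d 𝔄 ι e hL aS j.1 B) c c',
        fun j => v1CovBgEx d 𝔄 ι φ hL b α β j.1, fun _ _ => True, fun j => (fgInstanceV1GS d 𝔄 ι hL j.1).gc.dist⟩ ∧
      N15At { I := V1IndexSM d, c35 := c35, p := p, pi := fun j => fgInstanceV1GS d 𝔄 ι hL j.1, Kop := fun j => fgFamilyV1XAS d 𝔄 ι e hL b j.1,
              Ksite := cSiteExOn ι (fun j : V1IndexSM d => TGIndex.Mn d hL j.1.1.toTGIndex) (fun j => j.1.1.k) (fun j => j.1.1.m) (fun j => j.1.1.Msz)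
                (fun j => (Tor (fine (L ^ j.1.1.k) (TGIndex.Mn d hL j.1.1.toTGIndex)) × Fin (d + 1)) × ι) (fun j => liftBlk (blkFine L j.1.1.k (TGIndex.Mn d hL j.1.1.toTGIndex)) ι)
                (fun j => (fgInstanceV1GS d 𝔄 ι hL j.1).gf) (fun j => (fgInstanceV1GS d 𝔄 ι hL j.1).Bc) (fun j => (fgInstanceV1GS d 𝔄 ι hL j.1).Bf) aS
                (fun j => (fgInstanceV1GS d 𝔄 ι hL j.1).pair) (fun j A => adSitePertF d 𝔄 ι e hL aS j.1 A) (fun j B => adSitePertC d 𝔄 ι e hL aS j.1 B) c c',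
              Kunit := fun j => v1CovBgEx d 𝔄 ι φ hL b α β j.1, inΛ := fun _ _ => True, unitDist := fun j => (fgInstanceV1GS d 𝔄 ι hL j.1).gc.dist } :=
  ⟨live_v1XAS_site d 𝔄 ι hL hc35.le p _ _ _, n15At_v1XCol d 𝔄 ι e φ hd hLodd hL2 hL hb haS hc35 hφ α β p c c'⟩

end Knit

/-! ## §5 The `NE2Objects₁₁` literal of the family and its keyed faces (part XV's pattern) -/

section Record

/-- **N15's NE2 OBJECTS OF THE SIZED GAUGE-DRESSED FAMILY WITH THE NON-ABELIAN SITE LAYER** (RR-1's layer-A container): part XV's `v1XAllObjects` with the site kernel the `ad`-dressed coloured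
site socket at the colour entry `(c, c′)`. [bookkeeping] -/
def v1XColObjects (hL : Odd L ∧ 1 < L) (b aS : ℝ) (α β : Fin (d + 1)) (c35 p : ℝ) (c c' : V1IndexSM d → ι) : Node00.NE2Objects₁₁ where
  I := V1IndexSM d
  c35 := c35
  p := p
  pi := fun j => fgInstanceV1GS d 𝔄 ι hL j.1
  Kop := fun j => fgFamilyV1XAS d 𝔄 ι e hL b j.1
  Ksite := cSiteExOn ι (fun j : V1IndexSM d => TGIndex.Mn d hL j.1.1.toTGIndex) (fun j => j.1.1.k) (fun j => j.1.1.m) (fun j => j.1.1.Msz)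
    (fun j => (Tor (fine (L ^ j.1.1.k) (TGIndex.Mn d hL j.1.1.toTGIndex)) × Fin (d + 1)) × ι) (fun j => liftBlk (blkFine L j.1.1.k (TGIndex.Mn d hL j.1.1.toTGIndex)) ι)
    (fun j => (fgInstanceV1GS d 𝔄 ι hL j.1).gf) (fun j => (fgInstanceV1GS d 𝔄 ι hL j.1).Bc) (fun j => (fgInstanceV1GS d 𝔄 ι hL j.1).Bf) aS
    (fun j => (fgInstanceV1GS d 𝔄 ι hL j.1).pair) (fun j A => adSitePertF d 𝔄 ι e hL aS j.1 A) (fun j B => adSitePertC d 𝔄 ι e hL aS j.1 B) c c'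
  Kunit := fun j => v1CovBgEx d 𝔄 ι φ hL b α β j.1
  inΛ := fun _ _ => True
  unitDist := fun j => (fgInstanceV1GS d 𝔄 ι hL j.1).gc.dist

variable {d}

/-- ★★★ **`Live ∧ N15At` AT THE OBJECTS' BUNDLE** (`d ≥ 1`, odd `L ≥ 3`, `b, a_S, c₃₅ > 0`, `|φ| ≤ ‖·‖`, any colour entry). [bookkeeping] -/
theorem live_and_n15At_v1XColObjects (hd : 1 ≤ d) (hLodd : Odd L) (hL2 : 2 ≤ L) (hL : Odd L ∧ 1 < L) {b aS c35 : ℝ} (hb : 0 < b) (haS : 0 < aS) (hc35 : 0 < c35)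
    (hφ : ∀ a : 𝔄, |φ a| ≤ ‖a‖) (α β : Fin (d + 1)) (p : ℝ) (c c' : V1IndexSM d → ι) :
    Live (ne2OfRecord₁₁ (v1XColObjects d 𝔄 ι e φ hL b aS α β c35 p c c')) ∧ N15At (ne2OfRecord₁₁ (v1XColObjects d 𝔄 ι e φ hL b aS α β c35 p c c')) :=
  live_and_n15At_v1XCol d 𝔄 ι e φ hd hLodd hL2 hL hb haS hc35 hφ α β p c c'

omit [CompleteSpace 𝔄] [Nonempty ι] in
/-- RR-1's display: the objects are `Populated`. [bookkeeping] -/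
theorem populated_v1XColObjects (hL : Odd L ∧ 1 < L) (b aS : ℝ) (α β : Fin (d + 1)) (c35 p : ℝ) (c c' : V1IndexSM d → ι) :
    (v1XColObjects d 𝔄 ι e φ hL b aS α β c35 p c c').Populated :=
  (Node00.NE2Objects₁₁.populated_iff _).2 (v1IndexSM_nonempty d)

/-- `Live ∧ N15At` at the family-keyed literal (`d + 1 = 4`, the datum's own block factor `F.L`), for colour selectors given per family. [bookkeeping] -/
theorem live_and_n15At_v1XColObjects_family {b aS c35 : ℝ} (hb : 0 < b) (haS : 0 < aS) (hc35 : 0 < c35) (hφ : ∀ a : 𝔄, |φ a| ≤ ‖a‖) (α β : Fin 4) (p : ℝ)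
    (c c' : V1IndexSM 3 → ι) (F : T4Family) :
    Live (ne2OfRecord₁₁ (haveI := neZero_blockFactor F; v1XColObjects 3 𝔄 ι e φ F.hL b aS α β c35 p c c')) ∧
      N15At (ne2OfRecord₁₁ (haveI := neZero_blockFactor F; v1XColObjects 3 𝔄 ι e φ F.hL b aS α β c35 p c c')) := by
  haveI := neZero_blockFactor F
  exact live_and_n15At_v1XColObjects (d := 3) 𝔄 ι e φ (by norm_num) F.hL.1 (two_le_L F) F.hL hb haS hc35 hφ α β p c c'

variable {N : ℕ} [NeZero N] {key : (F : T4Family) → Datum F N → Prop}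

/-- ★★ **THE FAMILY-KEYED READING CLOSES THE STUB AT ANY KEYED HOME** (part 30's interface; `d + 1 = 4`, the datum's own block factor): a home admitting only the literals of a key-indexed NE2
reading whose value everywhere IS `v1XColObjects 3 …` has `S_N15 RRec` — the estimate is §4, not a hypothesis. [bookkeeping] -/
theorem s_N15_of_admits_v1XCol_family {b aS c35 : ℝ} (hb : 0 < b) (haS : 0 < aS) (hc35 : 0 < c35) (hφ : ∀ a : 𝔄, |φ a| ≤ ‖a‖) (α β : Fin 4) (p : ℝ) (c c' : V1IndexSM 3 → ι)
    (ne2At : ∀ {F : T4Family} {D : Datum F N}, key F D → (ℕ → ℝ) → List (ULoop F) → ℕ → Node00.NE2Objects₁₁) (RRec : RateRecordPred N)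
    (hadm : ∀ (F : T4Family) (D : Datum F N) (g₀ : ℕ → ℝ) (os : List (ULoop F)) (R : RateCarriers N), RRec F D g₀ os R →
      ∃ (h : key F D) (k : ℕ), R.ne2 = ne2OfRecord₁₁ (ne2At h g₀ os k))
    (h : ∀ (F : T4Family) (D : Datum F N) (h : key F D) (g₀ : ℕ → ℝ) (os : List (ULoop F)) (k : ℕ),
      ne2At h g₀ os k = haveI := neZero_blockFactor F; v1XColObjects 3 𝔄 ι e φ F.hL b aS α β c35 p c c') :
    S_N15 RRec := by
  refine s_N15_of_admits ne2At RRec hadm fun F D hk g₀ os k => ?_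
  rw [h F D hk g₀ os k]
  exact (live_and_n15At_v1XColObjects_family 𝔄 ι e φ hb haS hc35 hφ α β p c c' F).2

end Record

/-! ## §6 Positive control: the `ad`-species is not identically zero at a non-central constant gauge field -/

section PositiveControl

variable {𝔄} {ι}

omit [CompleteSpace 𝔄] [Nonempty ι] in
/-- Coordinates are faithful: an operator whose matrix in the coordinates `e` vanishes is zero. [folklore] -/
theorem eq_zero_of_coordMat_eq_zero (T : 𝔄 →L[ℝ] 𝔄) (h : coordMat e T = 0) : T = 0 := by
  have h1 : ((((e : 𝔄 →L[ℝ] (ι → ℝ)).comp (T.comp (e.symm : (ι → ℝ) →L[ℝ] 𝔄))) : (ι → ℝ) →L[ℝ] (ι → ℝ)) : (ι → ℝ) →ₗ[ℝ] (ι → ℝ)) = 0 :=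
    LinearMap.toMatrix'.map_eq_zero_iff.1 h
  ext x
  have h2 := LinearMap.congr_fun h1 (e x)
  simp only [ContinuousLinearMap.coe_coe, ContinuousLinearMap.coe_comp, Function.comp_apply, ContinuousLinearEquiv.coe_coe,
    ContinuousLinearEquiv.symm_apply_apply, LinearMap.zero_apply] at h2
  exact e.toLinearEquiv.map_eq_zero_iff.1 h2

omit [CompleteSpace 𝔄] [Nonempty ι] in
/-- A non-zero operator has a non-zero matrix entry in any coordinates. [folklore] -/
theorem exists_coordMat_ne_zero {T : 𝔄 →L[ℝ] 𝔄} (hT : T ≠ 0) : ∃ i j, coordMat e T i j ≠ 0 := by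
  by_contra hall
  push Not at hall
  exact hT (eq_zero_of_coordMat_eq_zero e T (Matrix.ext fun i j => hall i j))

variable (ι) (𝔄)

omit [CompleteSpace 𝔄] [Nonempty ι] in
/-- ★ **POSITIVE CONTROL — THE `ad`-SPECIES IS NOT IDENTICALLY ZERO**: at the CONSTANT gauge field `A′ ≡ a` with `a` NOT CENTRAL (`ad a ≠ 0`; such `a` lie in every (3.35) window wide
enough for `‖a‖`, one-step differences vanish), the fine `ad`-species `V̂(A′)` is a NON-ZERO operator: tested on the indicator of the gradient slot `((x, j), some μ)` it returns the matrix
entry `[ad a]_{ij} ≠ 0` at `(x, i)`.  So the colour-mixing site words of §§3–5 carry content exactly where the algebra is non-abelian — for commutative `𝔄` (`ad ≡ 0`) the species and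
the words' background dependence vanish identically, as they must (this answers, for the coloured layer, the remark that `φ = 0` inhabits part XV's hypotheses). [folklore] -/
theorem adSiteSpeciesF_const_ne_zero (hL : Odd L ∧ 1 < L) (j : TGIndexS × Fin (d + 1)) {a : 𝔄} (ha : adCLM ℝ a ≠ 0) :
    adSiteSpeciesF d 𝔄 ι e hL j (fun _ _ => a) ≠ 0 := by
  classical
  obtain ⟨i, c, hic⟩ := exists_coordMat_ne_zero e ha
  intro h0
  set x : Tor (fine (L ^ j.1.m * L ^ j.1.k) (TGIndex.Mn d hL j.1.toTGIndex)) := 0 with hx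
  have heval := congr_fun (LinearMap.congr_fun h0 (Pi.single ((x, c), some (0 : Fin (d + 1))) 1)) (x, i)
  rw [LinearMap.zero_apply, Pi.zero_apply] at heval
  unfold adSiteSpeciesF at heval
  rw [unstackM_apply] at heval
  have h1 : ∑ j' : ι, (0 : Matrix ι ι ℝ) i j' * Pi.single (M := fun _ => ℝ) ((x, c), some (0 : Fin (d + 1))) (1 : ℝ) ((x, j'), none) = 0 :=
    Finset.sum_eq_zero fun j' _ => by rw [Matrix.zero_apply, zero_mul]
  have h2 : ∑ μ : Fin (d + 1), ∑ j' : ι, coordMat e (adCLM ℝ a) i j' * Pi.single (M := fun _ => ℝ) ((x, c), some (0 : Fin (d + 1))) (1 : ℝ) ((x, j'), some μ)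
      = coordMat e (adCLM ℝ a) i c := by
    rw [Finset.sum_eq_single (0 : Fin (d + 1)) (fun μ _ hμ => Finset.sum_eq_zero fun j' _ => by
      rw [Pi.single_eq_of_ne (fun h => hμ (Option.some_injective _ (congrArg Prod.snd h))), mul_zero]) (fun h => (h (Finset.mem_univ _)).elim)]
    rw [Finset.sum_eq_single c (fun j' _ hj' => by rw [Pi.single_eq_of_ne (fun h => hj' (congrArg Prod.snd (congrArg Prod.fst h))), mul_zero])
      (fun h => (h (Finset.mem_univ _)).elim)]
    rw [Pi.single_eq_same, mul_one]
  rw [h1, h2, zero_add] at heval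
  exact hic heval

end PositiveControl

end Summit.QuantumFields.YangMills.BalabanUVNodes.N15.SiteLayerBg

end
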